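import Literature.AlgebraicGeometry.Frobenioids.PerfectionCoAngularDivisors
import Literature.AlgebraicGeometry.Frobenioids.PerfectionPullbackMorphisms
import HarnessLib

/-!
# Frobenioids I, Proposition 3.2 (ii)/(iii) for THE perfection: the class of a pull-back morphism of `C`
# at ANY level is a pull-back morphism of `C^pf` (PROOFS)

Mochizuki, *The geometry of Frobenioids I: the general theory*, Kyushu J. Math. **62** (2008)
293–400, Proposition 3.2 (ii) p. 59 ("An arrow of `C^pf` is a … pull-back morphism … if … a cofinal
collection of the system of arrows of `C` that determine this arrow of `C^pf` is so"), Proposition 1.10 (i)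
p. 34 [cite: MochizukiFrdI2008, Prop. 3.2 (ii) p.59].

PROOF-ONLY piece of the row «`C^pf` is a Frobenioid» (row `FrdI:Prop3.2(iii)-frobenioid`, carve-up v2 of
2026-08-26, L1-lead R99 (2): Def. 1.3 (iv)/(vi) for `Perfection.ops hF`, seat abc-iut-w5-d246).  This file
generalizes `isPullbackMorphism_toPf_map` (`PerfectionPullbackMorphisms.lean`, level `(1, 1)`) to arbitrary
representatives, the input of Def. 1.3 (iv)(a)(b) for `C^pf` (`PerfectionFactorization.lean`):

* `existsUnique_lift_aligned`: for a pull-back morphism `R : A^{(p)} → B^{(q)}` of `C` and a second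
  representative `c : A'^{(p')} → B^{(q)}` INTO THE SAME POWER `B^{(q)}`, every base datum
  `β : Base A' → Base A` over `Base [R]` lifts uniquely: `∃! ψ : (A', n') → (A, n)` with `ψ ≫ [R] = [c]`,
  `Base ψ = β` (existence from the pull-back property of `R` at the aligned level; uniqueness: two lifts
  agree after transport to a common level, by the uniqueness half of the pull-back property of a further
  transport of `R`, Prop. 1.10 (i) = `IsPullbackMorphism.frobeniusConjugate`);
* `isPullbackMorphism_mk_of`: the class of ANY representative `ρ : A^{(a)} → B^{(b)}` that is a pull-back
  morphism of `C` is a pull-back morphism of `C^pf` (transport `ρ` and the test arrow to the common target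
  power `B^{(b·b')}`).
No new definitions; nothing here is specific to the abc programme.
-/

namespace Literature.AlgebraicGeometry.Frobenioids

namespace PreFrobenioid

namespace Perfection

open CategoryTheory Opposite

universe w v v' u u'

variable {D : Type u} [Category.{v} D] {Φ : Dᵒᵖ ⥤ CommMonCat.{w}}
  {C : Type u'} [Category.{v'} C] {F : C ⥤ ElemFrobenioid Φ} {hF : IsFrobenioid F}

/-! ### Transports of pull-back representatives -/

/-- The transport of a pull-back representative to a higher level is a pull-back morphism of `C`
(Prop. 1.10 (i)). [cite: MochizukiFrdI2008, Prop. 1.10 (i) p.34] -/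
theorem isPullbackMorphism_lift {X Y : Perfection hF} (r : Rep X Y) (hr : PreFrobenioid.IsPullbackMorphism F r.hom)
    (L : Level X Y) (h : r.L.LE L) : PreFrobenioid.IsPullbackMorphism F (Level.lift r.L L h r.hom) :=
  IsPullbackMorphism.frobeniusConjugate hF hr (Level.lift_spec r.L L h r.hom)
    (isFrobeniusType_frobTrans hF X.obj h.1) (isFrobeniusType_frobTrans hF Y.obj h.2) (Level.degFr_eq r.L L h)

/-! ### Unique lifting at an aligned target level -/

/-- **Unique lifting through a pull-back representative at an aligned target power.**  For a pull-back
morphism `R : A^{(p)} → B^{(q)}` of `C`, an arrow `c : A'^{(p')} → B^{(q)}` of `C` and a base datum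
`β : Base A' → Base A` with `β ≫ Base [R] = Base [c]`, there is a unique `ψ : (A', n') → (A, n)` in `C^pf`
with `ψ ≫ [R] = [c]` and `Base ψ = β`. [cite: MochizukiFrdI2008, Prop. 3.2 (ii) p.59] -/
theorem existsUnique_lift_aligned {X X' Y : Perfection hF} (p q p' : ℕ+) (hpq : X.idx * p = Y.idx * q)
    (hp'q : X'.idx * p' = Y.idx * q) (R : frobPow hF X.obj p ⟶ frobPow hF Y.obj q)
    (hR : PreFrobenioid.IsPullbackMorphism F R) (c : frobPow hF X'.obj p' ⟶ frobPow hF Y.obj q)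
    (β : baseObj F X'.obj ⟶ baseObj F X.obj)
    (hβ : β ≫ Rep.baseMap (⟨⟨p, q, hpq⟩, R⟩ : Rep X Y) = Rep.baseMap (⟨⟨p', q, hp'q⟩, c⟩ : Rep X' Y)) :
    ∃! ψ : X' ⟶ X, ψ ≫ Hom.mk (⟨⟨p, q, hpq⟩, R⟩ : Rep X Y) = Hom.mk (⟨⟨p', q, hp'q⟩, c⟩ : Rep X' Y) ∧
      (ops hF).base.map ψ = β := by
  have hlev : X'.idx * p' = X.idx * p := hp'q.trans hpq.symm
  -- EXISTENCE: lift `c` through `R` at the aligned level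
  have hcompat : Base F c = (baseInvFrob hF X'.obj p' ≫ β ≫ Base F (frob hF X.obj p)) ≫ Base F R := by
    rw [base_hom_eq (hF := hF) (X := X') (Y := Y) ⟨⟨p', q, hp'q⟩, c⟩, ← hβ,
      base_hom_eq (hF := hF) (X := X) (Y := Y) ⟨⟨p, q, hpq⟩, R⟩]
    simp only [Category.assoc, base_frob_baseInvFrob_assoc]
  obtain ⟨ψ₀, hψ₀⟩ := (hR (frobPow hF X'.obj p')).2 ⟨(c, baseInvFrob hF X'.obj p' ≫ β ≫ Base F (frob hF X.obj p)), hcompat⟩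
  have hψ₁ : ψ₀ ≫ R = c := congrArg (fun w => w.1.1) hψ₀
  have hψ₂ : Base F ψ₀ = baseInvFrob hF X'.obj p' ≫ β ≫ Base F (frob hF X.obj p) := congrArg (fun w => w.1.2) hψ₀
  have hbase : Rep.baseMap (X := X') (Y := X) ⟨⟨p', p, hlev⟩, ψ₀⟩ = β := by
    change Base F (frob hF X'.obj p') ≫ Base F ψ₀ ≫ baseInvFrob hF X.obj p = β
    rw [hψ₂]
    simp only [Category.assoc, base_frob_baseInvFrob, base_frob_baseInvFrob_assoc, Category.comp_id]
  refine ⟨Hom.mk ⟨⟨p', p, hlev⟩, ψ₀⟩, ⟨?_, hbase⟩, ?_⟩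
  · rw [mk_comp_mk_aligned, hψ₁]
  -- UNIQUENESS
  rintro ψ' ⟨hc', hb'⟩
  obtain ⟨⟨⟨p₁, q₁, hpq₁⟩, s⟩, rfl⟩ := Hom.mk_surjective ψ'
  change X'.idx * p₁ = X.idx * q₁ at hpq₁
  change (frobPow hF X'.obj p₁ ⟶ frobPow hF X.obj q₁) at s
  change Rep.baseMap (X := X') (Y := X) ⟨⟨p₁, q₁, hpq₁⟩, s⟩ = β at hb'
  -- a common level `(p₁·p', p·k)` of the two lifts, `p·k = q₁·p'`
  have hsw : q₁ * p' = p₁ * p := by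
    apply mul_left_cancel (a := X.idx)
    calc X.idx * (q₁ * p') = X.idx * q₁ * p' := by rw [mul_assoc]
      _ = X'.idx * p₁ * p' := by rw [hpq₁]
      _ = X'.idx * p' * p₁ := by ac_rfl
      _ = X.idx * p * p₁ := by rw [hlev]
      _ = X.idx * (p₁ * p) := by ac_rfl
  obtain ⟨k, hk⟩ : p ∣ q₁ * p' := Dvd.intro p₁ (by rw [mul_comm p p₁, hsw])
  have hM : X'.idx * (p₁ * p') = X.idx * (p * k) := by rw [← hk, ← mul_assoc, hpq₁, mul_assoc]
  have h₁M : Level.LE (⟨p₁, q₁, hpq₁⟩ : Level X' X) ⟨p₁ * p', p * k, hM⟩ :=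
    ⟨dvd_mul_right _ _, Dvd.intro p' hk⟩
  have h₂M : Level.LE (⟨p', p, hlev⟩ : Level X' X) ⟨p₁ * p', p * k, hM⟩ := ⟨dvd_mul_left _ _, dvd_mul_right _ _⟩
  -- `R` scaled by `k`
  have hRk : X.idx * (p * k) = Y.idx * (q * k) := by rw [← mul_assoc, hpq, mul_assoc]
  have hk' : Level.LE (⟨p, q, hpq⟩ : Level X Y) ⟨p * k, q * k, hRk⟩ := ⟨dvd_mul_right _ _, dvd_mul_right _ _⟩
  -- both composites agree in `C^pf`
  have hcc : (Hom.mk (⟨⟨p₁, q₁, hpq₁⟩, s⟩ : Rep X' X) ≫ Hom.mk (⟨⟨p, q, hpq⟩, R⟩ : Rep X Y) : X' ⟶ Y) =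
      (Hom.mk (⟨⟨p', p, hlev⟩, ψ₀⟩ : Rep X' X) ≫ Hom.mk (⟨⟨p, q, hpq⟩, R⟩ : Rep X Y) : X' ⟶ Y) := by
    rw [hc', mk_comp_mk_aligned, hψ₁]
  rw [← Hom.mk_lift (⟨⟨p₁, q₁, hpq₁⟩, s⟩ : Rep X' X) ⟨p₁ * p', p * k, hM⟩ h₁M,
    ← Hom.mk_lift (⟨⟨p', p, hlev⟩, ψ₀⟩ : Rep X' X) ⟨p₁ * p', p * k, hM⟩ h₂M,
    ← Hom.mk_lift (⟨⟨p, q, hpq⟩, R⟩ : Rep X Y) ⟨p * k, q * k, hRk⟩ hk'] at hcc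
  change (Hom.mk (⟨⟨p₁ * p', p * k, hM⟩, Level.lift _ _ h₁M s⟩ : Rep X' X) ≫
      Hom.mk (⟨⟨p * k, q * k, hRk⟩, Level.lift _ _ hk' R⟩ : Rep X Y) : X' ⟶ Y) =
    (Hom.mk (⟨⟨p₁ * p', p * k, hM⟩, Level.lift _ _ h₂M ψ₀⟩ : Rep X' X) ≫
      Hom.mk (⟨⟨p * k, q * k, hRk⟩, Level.lift _ _ hk' R⟩ : Rep X Y) : X' ⟶ Y) at hcc
  rw [mk_comp_mk_aligned, mk_comp_mk_aligned] at hcc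
  -- bases of the two lifts
  have hbs : Rep.baseMap (X := X') (Y := X) ⟨⟨p₁ * p', p * k, hM⟩, Level.lift _ _ h₁M s⟩ = β :=
    (baseMap_lift _ _ h₁M s).trans hb'
  have hbψ : Rep.baseMap (X := X') (Y := X) ⟨⟨p₁ * p', p * k, hM⟩, Level.lift _ _ h₂M ψ₀⟩ = β :=
    (baseMap_lift _ _ h₂M ψ₀).trans hbase
  have hRk' : PreFrobenioid.IsPullbackMorphism F (Level.lift (⟨p, q, hpq⟩ : Level X Y) ⟨p * k, q * k, hRk⟩ hk' R) :=
    isPullbackMorphism_lift ⟨⟨p, q, hpq⟩, R⟩ hR _ hk'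
  generalize hs₁def : Level.lift (⟨p₁, q₁, hpq₁⟩ : Level X' X) ⟨p₁ * p', p * k, hM⟩ h₁M s = s₁ at hcc hbs
  generalize hs₂def : Level.lift (⟨p', p, hlev⟩ : Level X' X) ⟨p₁ * p', p * k, hM⟩ h₂M ψ₀ = s₂ at hcc hbψ
  generalize Level.lift (⟨p, q, hpq⟩ : Level X Y) ⟨p * k, q * k, hRk⟩ hk' R = R' at hcc hRk'
  -- a common higher level `N = (p₁ p' t, q k t)` where the composites agree on the nose
  obtain ⟨⟨Na, Nb, hNab⟩, hN₁, hN₂, e⟩ := Hom.mk_eq_mk.mp hcc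
  obtain ⟨t, rfl⟩ : p₁ * p' ∣ Na := hN₁.1
  have hNb : Nb = q * k * t :=
    mul_left_cancel (a := Y.idx)
      (calc Y.idx * Nb = X'.idx * (p₁ * p' * t) := hNab.symm
        _ = X'.idx * (p₁ * p') * t := (mul_assoc _ _ _).symm
        _ = X.idx * (p * k) * t := by rw [hM]
        _ = Y.idx * (q * k) * t := by rw [hRk]
        _ = Y.idx * (q * k * t) := mul_assoc _ _ _)
  subst hNb
  have hmid : X'.idx * (p₁ * p' * t) = X.idx * (p * k * t) := by rw [← mul_assoc, hM, mul_assoc]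
  have hd₁ : PreFrobenioid.degFr F (frobTrans hF X'.obj (dvd_mul_right (p₁ * p') t)) =
      PreFrobenioid.degFr F (frobTrans hF X.obj (dvd_mul_right (p * k) t)) :=
    Level.degFr_eq (⟨p₁ * p', p * k, hM⟩ : Level X' X) ⟨p₁ * p' * t, p * k * t, hmid⟩
      ⟨dvd_mul_right _ t, dvd_mul_right _ t⟩
  have hd₂ : PreFrobenioid.degFr F (frobTrans hF X.obj (dvd_mul_right (p * k) t)) =
      PreFrobenioid.degFr F (frobTrans hF Y.obj (dvd_mul_right (q * k) t)) :=
    Level.degFr_eq (⟨p * k, q * k, hRk⟩ : Level X Y) ⟨p * k * t, q * k * t, by rw [← mul_assoc, hRk, mul_assoc]⟩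
      ⟨dvd_mul_right _ t, dvd_mul_right _ t⟩
  have e₁ := liftLevel_comp hF s₁ R' (dvd_mul_right _ t) (dvd_mul_right _ t) (dvd_mul_right _ t) hd₁ hd₂
  have e₂ := liftLevel_comp hF s₂ R' (dvd_mul_right _ t) (dvd_mul_right _ t) (dvd_mul_right _ t) hd₁ hd₂
  have e' : liftLevel hF s₁ _ _ hd₁ ≫ liftLevel hF R' _ _ hd₂ = liftLevel hF s₂ _ _ hd₁ ≫ liftLevel hF R' _ _ hd₂ :=
    e₁.symm.trans (e.trans e₂)
  -- the transport of `R'` is a pull-back morphism; the two transported lifts have the same `Base`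
  have hR'' : PreFrobenioid.IsPullbackMorphism F (liftLevel hF R' (dvd_mul_right (p * k) t) (dvd_mul_right (q * k) t) hd₂) :=
    isPullbackMorphism_lift (⟨⟨p * k, q * k, hRk⟩, R'⟩ : Rep X Y) hRk'
      ⟨p * k * t, q * k * t, by rw [← mul_assoc, hRk, mul_assoc]⟩ ⟨dvd_mul_right _ t, dvd_mul_right _ t⟩
  have hB₁ : Base F (liftLevel hF s₁ (dvd_mul_right (p₁ * p') t) (dvd_mul_right (p * k) t) hd₁) =
      baseInvFrob hF X'.obj (p₁ * p' * t) ≫ β ≫ Base F (frob hF X.obj (p * k * t)) :=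
    base_hom_eq_of_baseMap_eq (X := X') (Y := X) ⟨⟨p₁ * p' * t, p * k * t, hmid⟩, _⟩
      ((baseMap_lift (⟨p₁ * p', p * k, hM⟩ : Level X' X) ⟨_, _, hmid⟩ ⟨dvd_mul_right _ t, dvd_mul_right _ t⟩ s₁).trans hbs)
  have hB₂ : Base F (liftLevel hF s₂ (dvd_mul_right (p₁ * p') t) (dvd_mul_right (p * k) t) hd₁) =
      baseInvFrob hF X'.obj (p₁ * p' * t) ≫ β ≫ Base F (frob hF X.obj (p * k * t)) :=
    base_hom_eq_of_baseMap_eq (X := X') (Y := X) ⟨⟨p₁ * p' * t, p * k * t, hmid⟩, _⟩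
      ((baseMap_lift (⟨p₁ * p', p * k, hM⟩ : Level X' X) ⟨_, _, hmid⟩ ⟨dvd_mul_right _ t, dvd_mul_right _ t⟩ s₂).trans hbψ)
  have huN := (hR'' (frobPow hF X'.obj (p₁ * p' * t))).1 (Subtype.ext (Prod.ext e' (hB₁.trans hB₂.symm)))
  have hMN : Level.LE (⟨p₁ * p', p * k, hM⟩ : Level X' X) ⟨p₁ * p' * t, p * k * t, hmid⟩ :=
    ⟨dvd_mul_right _ t, dvd_mul_right _ t⟩
  refine Hom.mk_eq_mk.mpr ⟨⟨p₁ * p' * t, p * k * t, hmid⟩, h₁M.trans hMN, h₂M.trans hMN, ?_⟩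
  change Level.lift (⟨p₁, q₁, hpq₁⟩ : Level X' X) ⟨p₁ * p' * t, p * k * t, hmid⟩ (h₁M.trans hMN) s =
    Level.lift (⟨p', p, hlev⟩ : Level X' X) ⟨p₁ * p' * t, p * k * t, hmid⟩ (h₂M.trans hMN) ψ₀
  rw [← Level.lift_trans h₁M hMN s, ← Level.lift_trans h₂M hMN ψ₀, hs₁def, hs₂def]
  exact huN

/-! ### The class of a pull-back representative is a pull-back morphism of `C^pf` -/

/-- **Prop. 3.2 (ii), pull-back morphisms, at any level**: the class `[ρ] : (A, n) → (B, m)` of a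
representative `ρ : A^{(a)} → B^{(b)}` that is a pull-back morphism of `C` is a pull-back morphism of `C^pf`
(for the operations `Perfection.ops hF` over `D`). [cite: MochizukiFrdI2008, Prop. 3.2 (ii) p.59] -/
theorem isPullbackMorphism_mk_of {X Y : Perfection hF} (a b : ℕ+) (hab : X.idx * a = Y.idx * b)
    (ρ : frobPow hF X.obj a ⟶ frobPow hF Y.obj b) (hρ : PreFrobenioid.IsPullbackMorphism F ρ) :
    (ops hF).IsPullbackMorphism (Hom.mk (⟨⟨a, b, hab⟩, ρ⟩ : Rep X Y) : X ⟶ Y) := by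
  intro X' χ β hβ
  change (baseObj F X'.obj ⟶ baseObj F X.obj) at β
  obtain ⟨⟨⟨a', b', hab'⟩, c⟩, rfl⟩ := Hom.mk_surjective χ
  change X'.idx * a' = Y.idx * b' at hab'
  change (frobPow hF X'.obj a' ⟶ frobPow hF Y.obj b') at c
  change β ≫ Rep.baseMap (⟨⟨a, b, hab⟩, ρ⟩ : Rep X Y) = Rep.baseMap (⟨⟨a', b', hab'⟩, c⟩ : Rep X' Y) at hβ
  -- transport both to the common target power `B^{(b·b')}`
  have hL₁ : X.idx * (a * b') = Y.idx * (b * b') := by rw [← mul_assoc, hab, mul_assoc]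
  have hL₂ : X'.idx * (a' * b) = Y.idx * (b * b') := by rw [← mul_assoc, hab', mul_assoc, mul_comm b' b]
  have h₁ : Level.LE (⟨a, b, hab⟩ : Level X Y) ⟨a * b', b * b', hL₁⟩ := ⟨dvd_mul_right _ _, dvd_mul_right _ _⟩
  have h₂ : Level.LE (⟨a', b', hab'⟩ : Level X' Y) ⟨a' * b, b * b', hL₂⟩ := ⟨dvd_mul_right _ _, dvd_mul_left _ _⟩
  have hR : PreFrobenioid.IsPullbackMorphism F (Level.lift (⟨a, b, hab⟩ : Level X Y) ⟨a * b', b * b', hL₁⟩ h₁ ρ) :=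
    isPullbackMorphism_lift ⟨⟨a, b, hab⟩, ρ⟩ hρ _ h₁
  rw [← baseMap_lift (⟨a, b, hab⟩ : Level X Y) ⟨a * b', b * b', hL₁⟩ h₁ ρ,
    ← baseMap_lift (⟨a', b', hab'⟩ : Level X' Y) ⟨a' * b, b * b', hL₂⟩ h₂ c] at hβ
  rw [← Hom.mk_lift (⟨⟨a, b, hab⟩, ρ⟩ : Rep X Y) ⟨a * b', b * b', hL₁⟩ h₁,
    ← Hom.mk_lift (⟨⟨a', b', hab'⟩, c⟩ : Rep X' Y) ⟨a' * b, b * b', hL₂⟩ h₂]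
  exact existsUnique_lift_aligned (a * b') (b * b') (a' * b) hL₁ hL₂ _ hR _ β hβ

end Perfection

end PreFrobenioid

end Literature.AlgebraicGeometry.Frobenioids
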